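import Literature.NumberTheory.EllipticCurves.CMSqrtEndomorphism
import Literature.NumberTheory.EllipticCurves.MordellCurvePhiDescentHom
import Literature.NumberTheory.EllipticCurves.IsogenyMordellWeilRankProofs
import HarnessLib

/-!
# The complex multiplication `[√−3]` on the Mordell curves `y² = x³ + B²` and the `φ`-descent kernel

Topic `NumberTheory/EllipticCurves`. For the Mordell curve `E' = E'_B : Y² = X³ + B²` over a field
`F` of characteristic `0` containing `θ = √−3` (and `B ≠ 0`), this file makes the endomorphism
`ψ = [√−3] ∈ End_F(E')` explicit and identifies its cokernel on `F`-points with the target of the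
`φ`-descent of `MordellCurvePhiDescentHom.lean`:

* `SqrtThree.veluFormula B`: Vélu's `3`-isogeny `E'_B → E'_B/⟨T'⟩ = (Y² = X³ − 27B²)` with kernel
  `⟨T'⟩`, `T' = (0, B)`, in the standard form `(U/h², S y/h³)` of the tree's `IsogenyFormula`
  (`U = X³ + 4B²`, `h = X`, `S = X³ − 8B²`, `T = 0`; Vélu 1971, tree `ThreeIsogeny`), and
  `SqrtThree.isTwistBy`: its codomain is the quadratic twist `E'^{(−3)}` (`a₆ ↦ (−3)³ a₆`), so that
  the tree's `IsogenyFormula.sqrtEndo` (file `CMSqrtEndomorphism`) gives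
* `SqrtThree.sqrtThree` — **the isogeny `ψ = [√−3] : E' → E'` over `F`** — with
  `SqrtThree.sqrtThree_comp_self`: **`ψ ∘ ψ = [−3]`** on `E'(F̄)` (tree `sqrtEndo_comp_self`, given an
  automorphism `σ` of `F̄` with `σ(θ) = −θ` fixing `B`);
* on `F`-points (`SqrtThree.sqrtThreeHom`, the tree's Galois descent `Isogeny.exists_pointHom`):
  `f ∘ f = −3` (`sqrtThreeHom_comp_self`), the explicit values
  `f(X, Y) = ((X³ + 4B²)/(−3X²), −(X³ − 8B²)Y/(3θX³))` (`sqrtThreeHom_some`), the kernel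
  `{O, ±T'}` (`sqrtThreeHom_eq_zero_iff`, `natCard_ker_sqrtThreeHom`), and
* for `B = 9c`: **the image of `f` is the image of the `3`-isogeny `φ : E → E'`** with kernel `μ₃`
  (`E : y² = x³ − 3c²`, the Vélu pair with parameters `(0, cθ)` of `MordellCurveThreeDescentKernel`):
  `f = −φ ∘ ι⁻¹` for the twisting isomorphism `ι(x, y) = (−3x, 3θy) : E ⥲ E'` over `F`
  (`range_sqrtThreeHom_eq`), whence by the exactness of the `φ`-descent
  (`exists_pointFun_eq_of_cubicDescentClass_eq_one`, `gFunW_pow_three` of the tree)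
  **`δ(P) = 1 ↔ P ∈ f(E'(F))`** for the descent map `δ : E'(F) → F^×/F^{×3}`, `(X, Y) ↦ Y + 9c`
  (the tree's `MordellDescent.cubicDescentClass`; `cubicDescentClass_eq_one_iff_mem_range`).

With the index count `[A : f(A)] = 3^{rank A/2 + 1}` for `f² = −3`, `#ker f = 3`
(`Literature/NumberTheory/EllipticCurves/IsogenyRangeIndex.lean`) this gives
`#δ(E'(K)) = 3^{rank E'(K)/2 + 1}` over a number field `K ∋ √−3` (sequel file): the input of the
`√−3`-descent computing the ranks of the cubic twists `y² = x³ + (2^a 5^b)²` for the barrier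
`Literature/Barriers/BirchSwinnertonDyer/RankNotSumOfLocalInvariantsCubicTwists.lean`.

## References

* J. H. Silverman, *The Arithmetic of Elliptic Curves*, 2nd ed., GTM 106 (2009): III.4.8,
  Remark III.4.13.3 (Vélu), Cor. III.6.3, X.4 (descent via isogeny; X.4.9 for the `2`-isogeny
  analogue), Exercise 10.1. [SilvermanAEC2009]
* J. H. Silverman, *Advanced Topics in the Arithmetic of Elliptic Curves*, GTM 151 (1994), II §2,
  Prop. II.2.3.1 (`[√d] = τ ∘ φ`). [SilvermanAdvancedTopics1994]
* J. W. S. Cassels, *Arithmetic on curves of genus 1. VI*, J. reine angew. Math. 214/215 (1964),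
  p. 65 (the descent map `Y + 9c` modulo cubes). [Cassels1964ArithmeticVI]
-/

noncomputable section

open scoped Classical

open WeierstrassCurve Polynomial

universe u

namespace Literature.NumberTheory.EllipticCurves

namespace SqrtThree

/-! ## Vélu's `3`-isogeny of `Y² = X³ + B²` in standard form, and its twist structure -/

section Formula

variable {F : Type u} [Field F]

/-- **Vélu's `3`-isogeny `E'_B → E'_B/⟨(0, B)⟩ : Y² = X³ − 27B²`** in the standard form
`(x, y) ↦ (U/h², S y/h³)`: `U = X³ + 4B²`, `h = X`, `S = X³ − 8B²`, `T = 0`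
(`(x, y) ↦ ((x³ + 4B²)/x², y(x³ − 8B²)/x³)`; tree `IsVeluThreePair.X/Y` with `m = 0`, `s = B`).
[cite: SilvermanAEC2009, Remark III.4.13.3] -/
def veluFormula (B : F) : IsogenyFormula (mordellCurve (B ^ 2)) (mordellCurve (-27 * B ^ 2)) where
  U := X ^ 3 + C (4 * B ^ 2)
  h := X
  S := X ^ 3 - C (8 * B ^ 2)
  T := 0
  identity₁ := by simp [mordellCurve]
  identity₀ := by
    simp only [mordellCurve, map_zero, zero_mul, mul_zero, add_zero,
      zero_pow two_ne_zero, C_mul, C_pow, C_neg, map_ofNat]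
    ring
  h_ne_zero := X_ne_zero
  natDegree_lt := by
    rw [natDegree_pow, natDegree_X, natDegree_X_pow_add_C]; norm_num

/-- The data of `veluFormula`. [folklore] -/
@[simp] theorem veluFormula_U (B : F) : (veluFormula B).U = X ^ 3 + C (4 * B ^ 2) := rfl
/-- The data of `veluFormula`. [folklore] -/
@[simp] theorem veluFormula_h (B : F) : (veluFormula B).h = X := rfl
/-- The data of `veluFormula`. [folklore] -/
@[simp] theorem veluFormula_S (B : F) : (veluFormula B).S = X ^ 3 - C (8 * B ^ 2) := rfl
/-- The data of `veluFormula`. [folklore] -/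
@[simp] theorem veluFormula_T (B : F) : (veluFormula B).T = 0 := rfl

/-- **The codomain of Vélu's `3`-isogeny is the quadratic twist `E'^{(−3)}`** (`a₆ ↦ (−3)³ a₆`):
the twisting data of the tree's `CMSqrtEndomorphism` for `d = −3`. [cite: SilvermanAEC2009, X.5 Prop. 5.4] -/
theorem isTwistBy (B : F) : (veluFormula B).IsTwistBy (-3) where
  a₁ := rfl
  a₂ := rfl
  a₃ := rfl
  a₁' := rfl
  a₂' := rfl
  a₃' := rfl
  a₄' := by simp [mordellCurve]
  a₆' := by simp [mordellCurve]; norm_num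
  T := rfl

variable [CharZero F]

/-- `θ² = −3` forces `θ ≠ 0`. [folklore] -/
theorem theta_ne_zero {θ : F} (hθ : θ ^ 2 = -3) : θ ≠ 0 := by
  rintro rfl; norm_num at hθ

/-- The Vélu pair `(0, B)`: `E'_B : Y² = X³ + B²` and `Y² = X³ − 27B²` (kernel `⟨(0, B)⟩`).
[folklore] -/
theorem isVeluThreePair_sq {B : F} (hB : B ≠ 0) :
    IsVeluThreePair 0 B (mordellCurve (B ^ 2)) (mordellCurve (-27 * B ^ 2)) where
  a₁_eq := rfl
  a₂_eq := by simp [mordellCurve]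
  a₃_eq := rfl
  a₄_eq := by simp [mordellCurve]
  a₆_eq := rfl
  a₁'_eq := rfl
  a₂'_eq := by simp [mordellCurve]
  a₃'_eq := rfl
  a₄'_eq := by simp [mordellCurve]
  a₆'_eq := by simp [mordellCurve]
  Δ_ne := by
    rw [mordellCurve_Δ]
    exact neg_ne_zero.mpr (mul_ne_zero (by norm_num) (pow_ne_zero 2 (pow_ne_zero 2 hB)))

/-- The Vélu pair `(0, cθ)`, `θ² = −3`: `E : y² = x³ − 3c²` and `E' : Y² = X³ + (9c)²` (kernel
`μ₃ = ⟨(0, cθ)⟩`; the pair of `MordellCurveThreeDescentKernel`, over a field containing `θ`).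
[folklore] -/
theorem isVeluThreePair_theta {c θ : F} (hc : c ≠ 0) (hθ : θ ^ 2 = -3) :
    IsVeluThreePair 0 (c * θ) (mordellCurve (-3 * c ^ 2)) (mordellCurve ((9 * c) ^ 2)) where
  a₁_eq := rfl
  a₂_eq := by simp [mordellCurve]
  a₃_eq := rfl
  a₄_eq := by simp [mordellCurve]
  a₆_eq := by simp only [mordellCurve_a₆]; linear_combination -c ^ 2 * hθ
  a₁'_eq := rfl
  a₂'_eq := by simp [mordellCurve]
  a₃'_eq := rfl
  a₄'_eq := by simp [mordellCurve]
  a₆'_eq := by simp only [mordellCurve_a₆]; linear_combination 27 * c ^ 2 * hθ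
  Δ_ne := by
    rw [mordellCurve_Δ]
    refine neg_ne_zero.mpr (mul_ne_zero (by norm_num) (pow_ne_zero 2 ?_))
    exact mul_ne_zero (by norm_num) (pow_ne_zero 2 hc)

end Formula

/-! ## The isogeny `ψ = [√−3] : E' → E'` and `ψ ∘ ψ = [−3]` -/

section Sqrt

variable {F : Type u} [Field F] [CharZero F] {B θ : F}

/-- **`ψ = [√−3] ∈ End_F(E'_B)`** for `F ∋ θ = √−3`: the isogeny attached to the twisted Vélu
formula `τ ∘ φ̂`, `τ(x, y) = (x/(−3), y/(−3θ))` (tree `IsogenyFormula.sqrtEndo`). Silverman,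
*Advanced Topics*, II §2. [cite: SilvermanAdvancedTopics1994, II §2, Prop. II.2.3.1] -/
def sqrtThree (hB : B ≠ 0) (hθ : θ ^ 2 = -3) :
    Isogeny (mordellCurve (B ^ 2)) (mordellCurve (B ^ 2)) :=
  haveI := isElliptic_mordellCurve (pow_ne_zero 2 hB)
  (veluFormula B).sqrtEndo (isTwistBy B) θ hθ (theta_ne_zero hθ)

/-- `X³ + 4B²` and `X` are coprime over `F̄` (`B ≠ 0`). [folklore] -/
theorem isCoprime_U_h (hB : B ≠ 0) :
    IsCoprime ((veluFormula B).U.map (algebraMap F (AlgebraicClosure F)))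
      ((veluFormula B).h.map (algebraMap F (AlgebraicClosure F))) := by
  set b : AlgebraicClosure F := algebraMap F _ (4 * B ^ 2) with hb
  have hb0 : b ≠ 0 := by
    rw [hb, map_ne_zero_iff _ (algebraMap F _).injective]
    exact mul_ne_zero (by norm_num) (pow_ne_zero 2 hB)
  refine ⟨C b⁻¹, -(C b⁻¹ * X ^ 2), ?_⟩
  simp only [veluFormula_U, veluFormula_h, Polynomial.map_add, Polynomial.map_pow, map_X, map_C]
  rw [← hb]
  calc C b⁻¹ * (X ^ 3 + C b) + -(C b⁻¹ * X ^ 2) * X = C b⁻¹ * C b := by ring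
    _ = 1 := by rw [← C_mul, inv_mul_cancel₀ hb0, C_1]

variable (σ : AlgebraicClosure F ≃+* AlgebraicClosure F)
  (hσθ : σ (algebraMap F _ θ) = -algebraMap F _ θ)
  (hσB : σ (algebraMap F _ B) = algebraMap F _ B)

omit [CharZero F] in
include hσB in
/-- `σ` fixes the coefficients of `E'_B` (it fixes `B`). [folklore] -/
theorem map_sigma_curve :
    ((mordellCurve (B ^ 2)).baseChange (AlgebraicClosure F)).map σ.toRingHom =
      (mordellCurve (B ^ 2)).baseChange (AlgebraicClosure F) := by
  rw [mordellCurve_baseChange, map_mordellCurve, map_pow, RingEquiv.toRingHom_eq_coe,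
    RingHom.coe_coe, map_pow, hσB]

omit [CharZero F] in
include hσB in
/-- `σ` fixes `U = X³ + 4B²` read over `F̄`. [folklore] -/
theorem map_sigma_U : ((veluFormula B).U.map (algebraMap F (AlgebraicClosure F))).map σ.toRingHom =
    (veluFormula B).U.map (algebraMap F (AlgebraicClosure F)) := by
  have h4 : σ (algebraMap F (AlgebraicClosure F) 4) = algebraMap F (AlgebraicClosure F) 4 := by
    rw [map_ofNat, map_ofNat]
  simp [veluFormula_U, hσB, h4]

omit [CharZero F] in
include hσB in
/-- `σ` fixes `S = X³ − 8B²` read over `F̄`. [folklore] -/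
theorem map_sigma_S : ((veluFormula B).S.map (algebraMap F (AlgebraicClosure F))).map σ.toRingHom =
    (veluFormula B).S.map (algebraMap F (AlgebraicClosure F)) := by
  have h8 : σ (algebraMap F (AlgebraicClosure F) 8) = algebraMap F (AlgebraicClosure F) 8 := by
    rw [map_ofNat, map_ofNat]
  simp [veluFormula_S, hσB, h8]

omit [CharZero F] in
/-- `σ` fixes `h = X`. [folklore] -/
theorem map_sigma_h : ((veluFormula B).h.map (algebraMap F (AlgebraicClosure F))).map σ.toRingHom =
    (veluFormula B).h.map (algebraMap F (AlgebraicClosure F)) := by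
  simp only [veluFormula_h, Polynomial.map_X]

include hσθ hσB in
/-- **`ψ ∘ ψ = [−3]` on `E'(F̄)`** (tree `IsogenyFormula.sqrtEndo_comp_self`: Cor. III.6.3 of *AEC*
and conjugation by `σ`, `σ(θ) = −θ`; `deg U = 3`). [cite: SilvermanAEC2009, Cor. III.6.3] -/
theorem sqrtThree_comp_self (hB : B ≠ 0) (hθ : θ ^ 2 = -3)
    (P : (mordellCurve (B ^ 2)).geomPoints) :
    sqrtThree hB hθ (sqrtThree hB hθ P) = -((3 : ℤ) • P) := by
  haveI := isElliptic_mordellCurve (pow_ne_zero 2 hB)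
  have h := IsogenyFormula.sqrtEndo_comp_self (veluFormula B) (isTwistBy B) θ hθ (theta_ne_zero hθ)
    σ hσθ (map_sigma_curve σ hσB) (map_sigma_U σ hσB) (map_sigma_h σ) (map_sigma_S σ hσB)
    (isCoprime_U_h hB) P
  have hdeg : (veluFormula B).U.natDegree = 3 := by
    rw [veluFormula_U, natDegree_X_pow_add_C]
  rw [hdeg] at h
  exact h

end Sqrt

/-! ## `ψ` on `F`-points: `f ∘ f = −3`, values, kernel -/

section Points

variable {F : Type u} [Field F] [CharZero F] {B θ : F}

/-- **`f : E'(F) →+ E'(F)`, the endomorphism `[√−3]` on `F`-rational points** (Galois descent of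
`ψ`, tree `WeierstrassCurve.Isogeny.exists_pointHom`): `E'(F) → E'(F̄) →ψ E'(F̄)` lands in `E'(F)`.
[cite: SilvermanAEC2009, III.4 and VIII.§1] -/
def sqrtThreeHom (hB : B ≠ 0) (hθ : θ ^ 2 = -3) :
    (mordellCurve (B ^ 2)).toAffine.Point →+ (mordellCurve (B ^ 2)).toAffine.Point :=
  (WeierstrassCurve.Isogeny.exists_pointHom (sqrtThree hB hθ)).choose

/-- The defining property of `sqrtThreeHom`: it is `ψ` on geometric points. [folklore] -/
theorem toGeomPoints_sqrtThreeHom (hB : B ≠ 0) (hθ : θ ^ 2 = -3)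
    (P : (mordellCurve (B ^ 2)).toAffine.Point) :
    (mordellCurve (B ^ 2)).toGeomPoints (sqrtThreeHom hB hθ P) =
      sqrtThree hB hθ ((mordellCurve (B ^ 2)).toGeomPoints P) :=
  (WeierstrassCurve.Isogeny.exists_pointHom (sqrtThree hB hθ)).choose_spec P

/-- **`f ∘ f = −3` on `E'(F)`** (from `ψ ∘ ψ = [−3]` on `E'(F̄)` and the injectivity of
`E'(F) ↪ E'(F̄)`), given an automorphism `σ` of `F̄` with `σ(θ) = −θ` fixing `B`.
[cite: SilvermanAEC2009, Cor. III.6.3] -/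
theorem sqrtThreeHom_comp_self (hB : B ≠ 0) (hθ : θ ^ 2 = -3)
    (σ : AlgebraicClosure F ≃+* AlgebraicClosure F)
    (hσθ : σ (algebraMap F _ θ) = -algebraMap F _ θ) (hσB : σ (algebraMap F _ B) = algebraMap F _ B)
    (P : (mordellCurve (B ^ 2)).toAffine.Point) :
    sqrtThreeHom hB hθ (sqrtThreeHom hB hθ P) = -(3 • P) := by
  apply WeierstrassCurve.toGeomPoints_injective
  rw [toGeomPoints_sqrtThreeHom, toGeomPoints_sqrtThreeHom, sqrtThree_comp_self σ hσθ hσB hB hθ,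
    map_neg, map_nsmul, ← natCast_zsmul]
  rfl

/-- Cross-multiplied form of the value of `[√−3]`: the point
`((X³ + 4B²)/(θX)², (X³ − 8B²)Y/(θX)³)` lies on `E'_B` whenever `(X, Y)` does and `X ≠ 0` (the
twisted formula lands on `E'`, tree `IsogenyFormula.nonsingular_val`). [folklore] -/
theorem nonsingular_value (hB : B ≠ 0) (hθ : θ ^ 2 = -3) {X Y : F}
    (h : (mordellCurve (B ^ 2)).toAffine.Nonsingular X Y) (hX : X ≠ 0) :
    (mordellCurve (B ^ 2)).toAffine.Nonsingular ((X ^ 3 + 4 * B ^ 2) / (θ * X) ^ 2)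
      ((X ^ 3 - 8 * B ^ 2) * Y / (θ * X) ^ 3) := by
  haveI := isElliptic_mordellCurve (pow_ne_zero 2 hB)
  have hx : ((veluFormula B).twist (isTwistBy B) θ hθ
      (IsogenyFormula.C_mul_cancel (theta_ne_zero hθ))).h.eval X ≠ 0 := by
    simp only [IsogenyFormula.twist_h, veluFormula_h, eval_mul, eval_C, eval_X]
    exact mul_ne_zero (theta_ne_zero hθ) hX
  have hv := ((veluFormula B).twist (isTwistBy B) θ hθ
    (IsogenyFormula.C_mul_cancel (theta_ne_zero hθ))).nonsingular_val h.1 hx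
  simp only [IsogenyFormula.valX, IsogenyFormula.valY, IsogenyFormula.twist_U,
    IsogenyFormula.twist_h, IsogenyFormula.twist_S, IsogenyFormula.twist_T, veluFormula_U,
    veluFormula_h, veluFormula_S, eval_add, eval_sub, eval_mul, eval_pow, eval_C, eval_X,
    eval_zero, add_zero] at hv
  convert hv using 2

omit [CharZero F] in
/-- Affine points with equal coordinates are equal (proof-irrelevance helper). [folklore] -/
theorem some_eq_some {K : Type*} [Field K] {W : WeierstrassCurve K} {x y x' y' : K}
    {h : W.toAffine.Nonsingular x y} {h' : W.toAffine.Nonsingular x' y'} (hx : x = x') (hy : y = y') :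
    Affine.Point.some x y h = Affine.Point.some x' y' h' := by
  subst hx hy
  rfl

omit [CharZero F] in
/-- The geometric point underlying a rational affine point, with prescribed coordinates
(proof-irrelevance helper). [folklore] -/
theorem toGeomPoints_some' (W : WeierstrassCurve F) {x y : F} (h : W.toAffine.Nonsingular x y)
    {x' y' : AlgebraicClosure F}
    (h' : (W.baseChange (AlgebraicClosure F)).toAffine.Nonsingular x' y')
    (hx : algebraMap F (AlgebraicClosure F) x = x') (hy : algebraMap F (AlgebraicClosure F) y = y') :
    W.toGeomPoints (Affine.Point.some x y h) = (Affine.Point.some x' y' h' : W.geomPoints) := by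
  subst hx hy
  rfl

omit [CharZero F] in
/-- Rational affine points give geometric affine points. [folklore] -/
theorem nonsingular_algebraMap (W : WeierstrassCurve F) {x y : F} (h : W.toAffine.Nonsingular x y) :
    (W.baseChange (AlgebraicClosure F)).toAffine.Nonsingular (algebraMap F (AlgebraicClosure F) x)
      (algebraMap F (AlgebraicClosure F) y) :=
  (Affine.map_nonsingular _ (algebraMap F (AlgebraicClosure F)).injective x y).mpr h

/-- **The value of `[√−3]` at an affine point off the kernel**:
`f(X, Y) = ((X³ + 4B²)/(θX)², (X³ − 8B²)Y/(θX)³)` for `X ≠ 0` (the twisted Vélu formula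
`τ ∘ φ̂`; tree `IsogenyFormula.sqrtEndo_some`). [cite: SilvermanAdvancedTopics1994, II §2, Prop. II.2.3.1] -/
theorem sqrtThreeHom_some (hB : B ≠ 0) (hθ : θ ^ 2 = -3) {X Y : F}
    (h : (mordellCurve (B ^ 2)).toAffine.Nonsingular X Y) (hX : X ≠ 0) :
    sqrtThreeHom hB hθ (.some X Y h) = .some _ _ (nonsingular_value hB hθ h hX) := by
  haveI := isElliptic_mordellCurve (pow_ne_zero 2 hB)
  apply WeierstrassCurve.toGeomPoints_injective
  set ι := algebraMap F (AlgebraicClosure F) with hι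
  have h1 := nonsingular_algebraMap (mordellCurve (B ^ 2)) h
  have h2 := nonsingular_algebraMap (mordellCurve (B ^ 2)) (nonsingular_value hB hθ h hX)
  have hx : ((veluFormula B).twistGeom (isTwistBy B) θ hθ (theta_ne_zero hθ)).h.eval (ι X) ≠ 0 := by
    rw [IsogenyFormula.twistGeom_h_eval, veluFormula_h, Polynomial.map_X, eval_X]
    exact mul_ne_zero ((map_ne_zero_iff _ ι.injective).mpr (theta_ne_zero hθ))
      ((map_ne_zero_iff _ ι.injective).mpr hX)
  rw [toGeomPoints_sqrtThreeHom, toGeomPoints_some' _ h h1 rfl rfl,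
    toGeomPoints_some' _ _ h2 rfl rfl, sqrtThree, IsogenyFormula.sqrtEndo_some _ _ _ _ _ h1 hx]
  refine some_eq_some ?_ ?_
  · simp only [IsogenyFormula.valX, IsogenyFormula.twistGeom, IsogenyFormula.geom,
      IsogenyFormula.map_U, IsogenyFormula.map_h, IsogenyFormula.twist_U, IsogenyFormula.twist_h,
      veluFormula_U, veluFormula_h, Polynomial.map_add, Polynomial.map_pow, Polynomial.map_mul,
      Polynomial.map_X, Polynomial.map_ofNat, map_C, eval_add, eval_pow, eval_mul, eval_X, eval_C,
      eval_ofNat, map_div₀, map_add, map_pow, map_mul, map_ofNat]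
  · simp only [IsogenyFormula.valY, IsogenyFormula.twistGeom, IsogenyFormula.geom,
      IsogenyFormula.map_S, IsogenyFormula.map_T, IsogenyFormula.map_h, IsogenyFormula.twist_S,
      IsogenyFormula.twist_T, IsogenyFormula.twist_h, veluFormula_S, veluFormula_h,
      Polynomial.map_sub, Polynomial.map_pow, Polynomial.map_mul, Polynomial.map_zero,
      Polynomial.map_X, Polynomial.map_ofNat, map_C, eval_sub, eval_pow, eval_mul, eval_X, eval_C,
      eval_zero, add_zero, eval_ofNat, map_div₀, map_sub, map_pow, map_mul, map_ofNat]

end Points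

/-! ## The kernel `{O, ±T'}` of `f` -/

section Kernel

variable {F : Type u} [Field F] [CharZero F] {B θ : F}

/-- The rational `3`-torsion point `T' = (0, B)` of `E'_B` (the tree's `IsVeluThreePair.T` of the
pair `(0, B)`). [folklore] -/
def T' (hB : B ≠ 0) : (mordellCurve (B ^ 2)).toAffine.Point := (isVeluThreePair_sq hB).T

/-- `3 T' = O`. [folklore] -/
theorem three_nsmul_T' (hB : B ≠ 0) : 3 • T' hB = (0 : (mordellCurve (B ^ 2)).toAffine.Point) := by
  rw [T', succ_nsmul, two_nsmul, (isVeluThreePair_sq hB).T_add_T, neg_add_cancel]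

/-- **`f P = O` forces `P ∈ {O, ±T'}`**: off `X = 0` the value of `f` is an affine point.
[folklore] -/
theorem eq_of_sqrtThreeHom_eq_zero (hB : B ≠ 0) (hθ : θ ^ 2 = -3)
    {P : (mordellCurve (B ^ 2)).toAffine.Point} (hP : sqrtThreeHom hB hθ P = 0) :
    P = 0 ∨ P = T' hB ∨ P = -T' hB := by
  rcases P with _ | ⟨X, Y, h⟩
  · exact Or.inl rfl
  · right
    by_cases hX : X = 0
    · exact (isVeluThreePair_sq hB).some_eq_T_or h hX
    · rw [sqrtThreeHom_some hB hθ h hX] at hP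
      exact absurd hP (Affine.Point.some_ne_zero _)

/-- **`f(T') = O`**: `f(f T') = −3T' = O` puts `f T'` in `{O, ±T'}`, and `f T' = ±T'` would give
`f(f T') = ±f T' ≠ O`. [folklore] -/
theorem sqrtThreeHom_T' (hB : B ≠ 0) (hθ : θ ^ 2 = -3)
    (σ : AlgebraicClosure F ≃+* AlgebraicClosure F)
    (hσθ : σ (algebraMap F _ θ) = -algebraMap F _ θ) (hσB : σ (algebraMap F _ B) = algebraMap F _ B) :
    sqrtThreeHom hB hθ (T' hB) = 0 := by
  set f := sqrtThreeHom hB hθ with hf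
  have hff : f (f (T' hB)) = 0 := by
    rw [sqrtThreeHom_comp_self hB hθ σ hσθ hσB, three_nsmul_T', neg_zero]
  have hT0 : T' hB ≠ 0 := (isVeluThreePair_sq hB).T_ne_zero
  have hTT : T' hB ≠ -T' hB := (isVeluThreePair_sq hB).T_ne_neg_T
  rcases eq_of_sqrtThreeHom_eq_zero hB hθ hff with h0 | h0 | h0
  · exact h0
  · exfalso
    -- `f T' = T'` gives `f (f T') = T' ≠ 0`
    rw [h0, h0] at hff
    exact hT0 hff
  · exfalso
    -- `f T' = -T'` gives `f (f T') = -f T' = T' ≠ 0`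
    rw [h0, map_neg, h0, neg_neg] at hff
    exact hT0 hff


/-- **The kernel of `f` is `{O, T', −T'}`.** [cite: SilvermanAEC2009, III.4.9] -/
theorem sqrtThreeHom_eq_zero_iff (hB : B ≠ 0) (hθ : θ ^ 2 = -3)
    (σ : AlgebraicClosure F ≃+* AlgebraicClosure F)
    (hσθ : σ (algebraMap F _ θ) = -algebraMap F _ θ) (hσB : σ (algebraMap F _ B) = algebraMap F _ B)
    (P : (mordellCurve (B ^ 2)).toAffine.Point) :
    sqrtThreeHom hB hθ P = 0 ↔ P = 0 ∨ P = T' hB ∨ P = -T' hB := by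
  refine ⟨eq_of_sqrtThreeHom_eq_zero hB hθ, ?_⟩
  rintro (rfl | rfl | rfl)
  · exact map_zero _
  · exact sqrtThreeHom_T' hB hθ σ hσθ hσB
  · rw [map_neg, sqrtThreeHom_T' hB hθ σ hσθ hσB, neg_zero]

/-- **`#ker f = 3`.** [cite: SilvermanAEC2009, III.4.9] -/
theorem natCard_ker_sqrtThreeHom (hB : B ≠ 0) (hθ : θ ^ 2 = -3)
    (σ : AlgebraicClosure F ≃+* AlgebraicClosure F)
    (hσθ : σ (algebraMap F _ θ) = -algebraMap F _ θ) (hσB : σ (algebraMap F _ B) = algebraMap F _ B) :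
    Nat.card (sqrtThreeHom hB hθ).ker = 3 := by
  have hT0 : T' hB ≠ 0 := (isVeluThreePair_sq hB).T_ne_zero
  have hTT : T' hB ≠ -T' hB := (isVeluThreePair_sq hB).T_ne_neg_T
  have hset : ((sqrtThreeHom hB hθ).ker : Set (mordellCurve (B ^ 2)).toAffine.Point) =
      {0, T' hB, -T' hB} := by
    ext P
    simp only [SetLike.mem_coe, AddMonoidHom.mem_ker, Set.mem_insert_iff, Set.mem_singleton_iff]
    exact sqrtThreeHom_eq_zero_iff hB hθ σ hσθ hσB P
  rw [← SetLike.coe_sort_coe, hset, Nat.card_coe_set_eq, Set.ncard_insert_of_notMem,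
    Set.ncard_pair hTT]
  simp only [Set.mem_insert_iff, Set.mem_singleton_iff, not_or]
  exact ⟨hT0.symm, fun h ↦ hT0 (neg_eq_zero.mp h.symm)⟩

end Kernel

/-! ## `B = 9c`: the image of `f` is the image of the `3`-isogeny `φ : E → E'` with kernel `μ₃` -/

section Image

variable {F : Type u} [Field F] [CharZero F] {c θ : F}

/-- `9c ≠ 0`. [folklore] -/
theorem nine_mul_ne_zero (hc : c ≠ 0) : (9 : F) * c ≠ 0 := mul_ne_zero (by norm_num) hc

/-- The point `(−X/3, −Y/(3θ))` of `E : y² = x³ − 3c²` attached to `(X, Y) ∈ E' : Y² = X³ + 81c²`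
(the twisting isomorphism `E' ≅ E` over `F ∋ θ`, composed with `−1`). [folklore] -/
theorem nonsingular_twistBack (hc : c ≠ 0) (hθ : θ ^ 2 = -3) {X Y : F}
    (h : (mordellCurve ((9 * c) ^ 2)).toAffine.Nonsingular X Y) :
    (mordellCurve (-3 * c ^ 2)).toAffine.Nonsingular (-X / 3) (-Y / (3 * θ)) := by
  have hE : Y ^ 2 = X ^ 3 + (9 * c) ^ 2 := (mordellCurve_equation_iff _ X Y).mp h.1
  refine nonsingular_mordellCurve_of_equation (mul_ne_zero (by norm_num) (pow_ne_zero 2 hc)) ?_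
  rw [mordellCurve_equation_iff]
  have hθ0 := theta_ne_zero hθ
  calc (-Y / (3 * θ)) ^ 2 = Y ^ 2 / (9 * θ ^ 2) := by field_simp; norm_num
    _ = (X ^ 3 + (9 * c) ^ 2) / (-27) := by rw [hθ, hE]; ring
    _ = (-X / 3) ^ 3 + -3 * c ^ 2 := by ring

/-- **`f = φ ∘ (−ι⁻¹)` off the kernel**: for `(X, Y) ∈ E'(F)` with `X ≠ 0`,
`f(X, Y) = φ(−X/3, −Y/(3θ))`, `φ` the Vélu `3`-isogeny with parameters `(0, cθ)`
(both are `((X³ + 324c²)/(−3X²), −Y(X³ − 648c²)/(3θX³))`).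
[cite: SilvermanAdvancedTopics1994, II §2, Prop. II.2.3.1] -/
theorem sqrtThreeHom_some_eq_pointFun (hc : c ≠ 0) (hθ : θ ^ 2 = -3) {X Y : F}
    (h : (mordellCurve ((9 * c) ^ 2)).toAffine.Nonsingular X Y) (hX : X ≠ 0) :
    sqrtThreeHom (nine_mul_ne_zero hc) hθ (.some X Y h) =
      (isVeluThreePair_theta hc hθ).pointFun (.some _ _ (nonsingular_twistBack hc hθ h)) := by
  have hx : -X / 3 ≠ 0 := div_ne_zero (neg_ne_zero.mpr hX) three_ne_zero
  rw [sqrtThreeHom_some _ hθ h hX, (isVeluThreePair_theta hc hθ).pointFun_some _ hx]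
  have hθ0 := theta_ne_zero hθ
  refine some_eq_some ?_ ?_
  · rw [MordellDescent.IsVeluPair.X_eq' (isVeluThreePair_theta hc hθ) hθ]
    field_simp
    linear_combination (X ^ 3 + 324 * c ^ 2) * hθ
  · rw [MordellDescent.IsVeluPair.Y_eq' (isVeluThreePair_theta hc hθ) hθ]
    field_simp
    linear_combination (X ^ 3 * Y - 648 * c ^ 2 * Y) * hθ

/-- **The image of `f` is the image of `φ : E(F) → E'(F)`** (`E : y² = x³ − 3c²`,
`E' : Y² = X³ + (9c)²`, `φ` the Vélu isogeny with kernel `μ₃ = ⟨(0, cθ)⟩`; `f = φ ∘ (−ι⁻¹)` for the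
isomorphism `ι : E ⥲ E'`, `(x, y) ↦ (−3x, −3θy)`, over `F ∋ θ`).
[cite: SilvermanAdvancedTopics1994, II §2, Prop. II.2.3.1] -/
theorem range_sqrtThreeHom_eq (hc : c ≠ 0) (hθ : θ ^ 2 = -3)
    (σ : AlgebraicClosure F ≃+* AlgebraicClosure F)
    (hσθ : σ (algebraMap F _ θ) = -algebraMap F _ θ) (hσc : σ (algebraMap F _ c) = algebraMap F _ c) :
    (sqrtThreeHom (nine_mul_ne_zero hc) hθ).range = (isVeluThreePair_theta hc hθ).pointHom.range := by
  have hσB : σ (algebraMap F _ (9 * c)) = algebraMap F _ (9 * c) := by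
    rw [map_mul, map_mul, hσc, map_ofNat, map_ofNat]
  set hV := isVeluThreePair_theta hc hθ
  ext P'
  simp only [AddMonoidHom.mem_range, IsVeluThreePair.pointHom_apply]
  constructor
  · rintro ⟨P, rfl⟩
    rcases P with _ | ⟨X, Y, h⟩
    · exact ⟨0, by rw [← Affine.Point.zero_def, map_zero, hV.pointFun_zero]⟩
    · by_cases hX : X = 0
      · refine ⟨0, ?_⟩
        rw [hV.pointFun_zero]
        rcases (isVeluThreePair_sq (nine_mul_ne_zero hc)).some_eq_T_or h hX with hT | hT
        · rw [hT]; exact (sqrtThreeHom_T' _ hθ σ hσθ hσB).symm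
        · rw [hT, map_neg, show (isVeluThreePair_sq (nine_mul_ne_zero hc)).T = T' (nine_mul_ne_zero hc)
            from rfl, sqrtThreeHom_T' _ hθ σ hσθ hσB, neg_zero]
      · exact ⟨_, (sqrtThreeHom_some_eq_pointFun hc hθ h hX).symm⟩
  · rintro ⟨Q, rfl⟩
    rcases Q with _ | ⟨x, y, h⟩
    · exact ⟨0, by rw [← Affine.Point.zero_def, map_zero, hV.pointFun_zero]⟩
    · by_cases hx : x = 0
      · exact ⟨0, by rw [map_zero, hV.pointFun_some_of_eq_zero _ hx]⟩
      · -- `(x, y) = (−X/3, −Y/(3θ))` for `(X, Y) = (−3x, −3θy)`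
        have hE : y ^ 2 = x ^ 3 - 3 * c ^ 2 := (MordellDescent.IsVeluPair.equation_iff' hV hθ x y).mp h.1
        have hP : (mordellCurve ((9 * c) ^ 2)).toAffine.Nonsingular (-3 * x) (-3 * θ * y) := by
          refine nonsingular_mordellCurve_of_equation (pow_ne_zero 2 (nine_mul_ne_zero hc)) ?_
          rw [mordellCurve_equation_iff]
          linear_combination (-27) * hE + 9 * y ^ 2 * hθ
        have hX : -3 * x ≠ 0 := mul_ne_zero (by norm_num) hx
        refine ⟨.some _ _ hP, ?_⟩
        rw [sqrtThreeHom_some_eq_pointFun hc hθ hP hX]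
        congr 1
        have hθ0 := theta_ne_zero hθ
        exact some_eq_some (by field_simp) (by field_simp)

end Image

/-! ## The `φ`-descent map `δ : (X, Y) ↦ Y + 9c` modulo cubes: `δ(P) = 1 ↔ P ∈ f(E'(F))` -/

section Descent

variable {F : Type u} [Field F] [CharZero F] {c θ : F}

open MordellDescent

/-- **`δ ∘ φ = 1`**: the descent class of `φ(Q)` is trivial for every `Q ∈ E(F)` — off the kernel
`Y(φ Q) + 9c = g_c(Q)³` (`gFunW_pow_three`), and when `Y(φ Q) = −9c` the value `(18c)²` equals
`(3x)³` (`x³ = 12c²` from `g_{−c}(Q)³ = −18c`, `g_c(Q) = 0`). [cite: Cassels1964ArithmeticVI, p. 65] -/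
theorem cubicDescentClass_pointFun (hc : c ≠ 0) (hθ : θ ^ 2 = -3)
    (Q : (mordellCurve (-3 * c ^ 2)).toAffine.Point) :
    cubicDescentClass (mordellCurve ((9 * c) ^ 2)) (9 * c) ((isVeluThreePair_theta hc hθ).pointFun Q) = 1 := by
  set hV := isVeluThreePair_theta hc hθ
  rcases Q with _ | ⟨x, y, h⟩
  · rw [← Affine.Point.zero_def, hV.pointFun_zero, cubicDescentClass_zero]
  · by_cases hx : x = 0
    · rw [hV.pointFun_some_of_eq_zero _ hx, cubicDescentClass_zero]
    · rw [hV.pointFun_some _ hx, cubicDescentClass, cubicDescent_some]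
      have hg := gFunW_pow_three hV hθ (e := c) rfl h hx
      have hg' := gFunW_pow_three hV hθ (e := -c) (by ring) h hx
      simp only [gFunW_some] at hg hg'
      split_ifs with hY
      · -- `Y = −9c`: `x³ = 12c²` and `(18c)² = (3x)³`
        rw [hY, neg_add_cancel, pow_eq_zero_iff three_ne_zero, div_eq_zero_iff] at hg
        have hy : y = -3 * c := by
          rcases hg with hg | hg
          · linear_combination hg
          · exact absurd hg hx
        rw [hY, hy, div_pow, div_eq_iff (pow_ne_zero 3 hx)] at hg'
        have hx3 : x ^ 3 = 12 * c ^ 2 := by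
          have h18 : (18 : F) * c ≠ 0 := mul_ne_zero (by norm_num) hc
          refine mul_left_cancel₀ h18 ?_
          linear_combination hg'
        rw [cubeClass_eq_one_iff (pow_ne_zero 2 (mul_ne_zero two_ne_zero (nine_mul_ne_zero hc)))]
        exact ⟨3 * x, mul_ne_zero three_ne_zero hx, by linear_combination (-27) * hx3⟩
      · rw [← hg, cubeClass_pow_three]

/-- **`ker δ = φ(E(F))`** for the `φ`-descent map `δ : (X, Y) ↦ [Y + 9c] ∈ F^×/F^{×3}` on
`E' : Y² = X³ + (9c)²` over `F ∋ θ = √−3` (tree `MordellDescent.cubicDescentClass`): `⊇` by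
`cubicDescentClass_pointFun`, `⊆` by the tree's exactness theorem
`exists_pointFun_eq_of_cubicDescentClass_eq_one` (Cassels' descent; Silverman X.4.9 for the
`2`-isogeny analogue). [cite: Cassels1964ArithmeticVI, p. 65] -/
theorem cubicDescentClass_eq_one_iff_mem_range_pointHom (hc : c ≠ 0) (hθ : θ ^ 2 = -3)
    (P' : (mordellCurve ((9 * c) ^ 2)).toAffine.Point) :
    cubicDescentClass (mordellCurve ((9 * c) ^ 2)) (9 * c) P' = 1 ↔
      P' ∈ (isVeluThreePair_theta hc hθ).pointHom.range := by
  rw [AddMonoidHom.mem_range]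
  constructor
  · intro h1
    obtain ⟨P, hP⟩ := exists_pointFun_eq_of_cubicDescentClass_eq_one (isVeluThreePair_theta hc hθ) hθ
      two_ne_zero three_ne_zero hc P' h1
    exact ⟨P, hP⟩
  · rintro ⟨Q, rfl⟩
    exact cubicDescentClass_pointFun hc hθ Q

/-- **`ker δ = f(E'(F))`**, `f = [√−3]` on `E'(F)`: a point of `E' : Y² = X³ + (9c)²` over
`F ∋ √−3` is divisible by `[√−3]` in `E'(F)` iff its `φ`-descent class `[Y + 9c] ∈ F^×/F^{×3}` is
trivial (`cubicDescentClass_eq_one_iff_mem_range_pointHom` and `range_sqrtThreeHom_eq`; the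
cokernel of `[√−3]` on `E'(F)` thus embeds into `F^×/F^{×3}`, the descent class being
multiplicative by the tree's `cubicDescentClass_add`). [cite: SilvermanAEC2009, X.4 Remark X.4.7] -/
theorem cubicDescentClass_eq_one_iff_mem_range (hc : c ≠ 0) (hθ : θ ^ 2 = -3)
    (σ : AlgebraicClosure F ≃+* AlgebraicClosure F)
    (hσθ : σ (algebraMap F _ θ) = -algebraMap F _ θ) (hσc : σ (algebraMap F _ c) = algebraMap F _ c)
    (P : (mordellCurve ((9 * c) ^ 2)).toAffine.Point) :
    cubicDescentClass (mordellCurve ((9 * c) ^ 2)) (9 * c) P = 1 ↔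
      P ∈ (sqrtThreeHom (nine_mul_ne_zero hc) hθ).range := by
  rw [cubicDescentClass_eq_one_iff_mem_range_pointHom hc hθ, range_sqrtThreeHom_eq hc hθ σ hσθ hσc]

end Descent

end SqrtThree

end Literature.NumberTheory.EllipticCurves

end
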